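import Summits.Ventures.PercRepro.ThetaOmegaCoreSquareMain

/-!
# The all-singleton regime of (Θ_∞) is a theorem

Dossier proofs/MINE1-theoremS.md, Addendum 83 (mine-1, gen 44). Conjecture (Θ_∞) of Addendum 72
(`ConjThetaMulti`: for classes `A : Fin m → Finset (Finset α)` with the families and their
complement families pairwise disjoint, `∑ |A i| ≤ |multiD A|`) has (Σ) as its all-singleton regime:
`conjSigma_of_conjThetaMulti` (ThetaSigma.lean) derives (Σ) from (Θ_∞) through the bridge
`sigmaD_image_eq_multiDRel`. With (Σ) now a theorem (`conjSigma_holds`), the same bridge runs the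
other way: **(Θ_∞) holds whenever every class is a singleton**, for any finite index type —

* `injective_of_multiValid_singleton` — validity of singleton classes makes the members distinct;
* `thetaMulti_singletons` — `∑ i, |{x i}| ≤ |multiD (fun i => {x i})|` for every valid family of
  singleton classes `fun i => {x i}`;
* `thetaMulti_fin_singletons` — the `Fin m`-indexed form, the instance of `ConjThetaMulti` with
  `m` singleton classes.

The regimes of (Θ_∞) now in the kernel are one class (Marica–Schönheim, Mathlib
`Finset.card_le_card_diffs`), two classes (`marica_schonheim_two_family` and the two-type theorem
of the lane) and all classes singletons (this file); the general conjecture stays open.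
-/

namespace PercRepro.MSTight

open Finset
open scoped FinsetFamily

variable {α : Type*} [DecidableEq α] [Fintype α]
variable {ι : Type*} [DecidableEq ι] [Fintype ι]

section Singletons

omit [Fintype ι] in
/-- Validity of a family of singleton classes forces the members to be pairwise distinct. -/
theorem injective_of_multiValid_singleton (x : ι → Finset α)
    (hv : MultiValid fun i => {x i}) : Function.Injective x := by
  intro i j hij
  by_contra hne
  have hd := (hv.2 i j hne).1
  rw [disjoint_singleton] at hd
  exact hd hij

/-- **(Θ_∞) on singleton classes**: for every valid family of singleton classes `fun i => {x i}`,
the number of classes is at most the size of the multi-class difference family — the all-singleton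
regime of Conjecture (Θ_∞), from `conjSigma_holds` through the bridge of ThetaSigma.lean. -/
theorem thetaMulti_singletons (x : ι → Finset α) (hv : MultiValid fun i => {x i}) :
    ∑ i, ({x i} : Finset (Finset α)).card ≤ (multiD fun i => {x i}).card := by
  have hinj := injective_of_multiValid_singleton x hv
  have hv' : SigmaValidRel univ (univ.image x) := by
    rw [← multiValidRel_singleton_iff_sigmaValidRel x hinj, multiValidRel_univ]
    exact hv
  have h := conjSigma_holds (univ.image x) hv'
  rw [sigmaD_image_eq_multiDRel x hinj, multiDRel_univ, card_image_of_injective _ hinj,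
    card_univ] at h
  simpa only [card_singleton, sum_const, card_univ, smul_eq_mul, mul_one] using h

/-- The `Fin m`-indexed form: the instance of `ConjThetaMulti` with `m` singleton classes. -/
theorem thetaMulti_fin_singletons (m : ℕ) (x : Fin m → Finset α)
    (hv : MultiValid fun i => {x i}) :
    ∑ i, ({x i} : Finset (Finset α)).card ≤ (multiD fun i => {x i}).card :=
  thetaMulti_singletons x hv

end Singletons

end PercRepro.MSTight
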